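import Summits.QuantumFields.YangMills.Theorems.SwapVirialDeficitNearFlatPairs
import HarnessLib

/-!
# NEAR-COMMUTING TUPLES WITH A HEAVY ELEMENT ARE NEAR COMMUTING (COAXIAL) TUPLES — step (iii) of the near-flat projection
# (free-hands support of ⟨stmt-QuantumFields-24197⟩ `SwapVirialDeficit.SwapGluedStiffness`; LEAD g98's plan of record memo7 §C(c) «matching»: `C ↦ C♭` at Lipschitz cost `1/‖im C_h‖`
# of the heaviest element; the σ-relations (iv) and the central-corner fallback (v) are the sequel)

Apply ✓`NearFlat.exists_coaxial_near` to every member of a tuple against a fixed heavy element `C_h` (`im C_h ≠ 0`): the new tuple is coaxial with `C_h` (hence pairwise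
commuting), keeps real parts and norms (so stays in `SU(2)` if it was there), fixes `C_h` itself, and moves `C_k` by at most `‖[C_h, C_k]‖/‖im C_h‖`:
* `coaxial_commute` — two quaternions with imaginary parts on the same axis commute;
* ★★ `exists_coaxial_tuple (C : ι → ℍ) (h : ι) (hh : (C h).im ≠ 0)`.

HONEST LABEL: elementary quaternion geometry; stubs of ➎, ⟨24197⟩ ∕ ⟨24194⟩ ∕ ⟨24497⟩ OPEN; own crux ⟨22884⟩ OPEN (blocked-on ⟨19935⟩); the Yang–Mills mass gap is NOT proved; no
summit is proved by a line.  THEOREMS ONLY (0 `def`, 0 `sorry`), standard axioms.  Width seat ym-line-sfw-p2-w3 g66 (cell ym-idea-1, free hands), `--supports stmt-QuantumFields-24197`.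
References: [folklore].
-/

set_option autoImplicit false

noncomputable section

open Quaternion
open scoped Quaternion

namespace Summit.QuantumFields.YangMills.Theorems.SwapVirialDeficit.NearFlat

/-- ★ Two quaternions whose imaginary parts lie on a common axis commute. [folklore] -/
theorem coaxial_commute {p a b : ℍ} (ha : ∃ t : ℝ, a.im = t • p.im) (hb : ∃ t : ℝ, b.im = t • p.im) : a * b = b * a := by
  obtain ⟨t, ht⟩ := ha
  obtain ⟨s, hs⟩ := hb
  have ea : a = (a.re : ℍ) + t • p.im := by rw [← ht]; exact (Quaternion.re_add_im a).symm
  have eb : b = (b.re : ℍ) + s • p.im := by rw [← hs]; exact (Quaternion.re_add_im b).symm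
  rw [ea, eb]
  ext <;> simp <;> ring

/-- ★★ **NEAR-COMMUTING WITH A HEAVY ELEMENT ⟹ NEAR A COAXIAL (COMMUTING) TUPLE**: for a tuple `C` and an index `h` with `im (C h) ≠ 0` there is a tuple `C′`, coaxial with
`C h` (so pairwise commuting), with the same real parts and norms, `C′ h = C h`, and `‖C k − C′ k‖ ≤ ‖C h·C k − C k·C h‖/‖im (C h)‖` for every `k`. [folklore] -/
theorem exists_coaxial_tuple {ι : Type*} (C : ι → ℍ) (h : ι) (hh : (C h).im ≠ 0) :
    ∃ C' : ι → ℍ, (∀ k, (C' k).re = (C k).re) ∧ (∀ k, ∃ t : ℝ, (C' k).im = t • (C h).im) ∧ (∀ k, ‖C' k‖ ^ 2 = ‖C k‖ ^ 2) ∧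
      (∀ k l, C' k * C' l = C' l * C' k) ∧ C' h = C h ∧ ∀ k, ‖C k - C' k‖ ≤ ‖C h * C k - C k * C h‖ / ‖(C h).im‖ := by
  choose F hre hax hnorm _hcomm hdist using fun k => exists_coaxial_near hh (C k)
  refine ⟨F, hre, hax, hnorm, fun k l => coaxial_commute (hax k) (hax l), ?_, hdist⟩
  -- `C′ h = C h`: its distance bound is `‖[C h, C h]‖/… = 0`
  have h0 : ‖C h - F h‖ ≤ 0 := by
    have := hdist h
    rwa [sub_self, norm_zero, zero_div] at this
  have : C h - F h = 0 := norm_le_zero_iff.1 h0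
  exact (sub_eq_zero.1 this).symm

end Summit.QuantumFields.YangMills.Theorems.SwapVirialDeficit.NearFlat

end
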